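import Summits.BirchSwinnertonDyer.BirchSwinnertonDyer.Theorems.PrintCFramBottomClassIndexLawFiveLeHerbrandKummerReflectionCountEven
import Summits.BirchSwinnertonDyer.BirchSwinnertonDyer.Theorems.PrintCFramBottomClassIndexLawFiveLeHerbrandKummerClassField
import HarnessLib

/-!
# Route `PrintCFram`, crux C2 `BottomClassIndexLawFiveLe` (stmt-BirchSwinnertonDyer-20372), line
# `eisenstein-resource-bdp-line` (B1 first-order census, CASE R): **LEOPOLDT'S REFLECTION, LOWER DIRECTION, AS A THEOREM** —
# `[Cl(K) : S] ≤ p · #e_{θ_e}(ℤ_p ⊗ Cl(K))` for every `Gal(K/ℚ)`-stable `S ≤ Cl(K)` of exponent `p` on whose quotient `Gal(K/ℚ)` acts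
# by the ODD character `χ̄ = m̄⁻¹`, `θ_e = ω χ̄⁻¹` even `≠ 1`; hence «`χ̄`-RANK `≥ 2` ⟹ EVEN-IRREGULAR»
# (cell `bsd-print-cfram`, width seat `bsd-line-cfram-p1-w7` g4; helper `--supports` 20372; 0 defs, 0 facts, 0 sorry)

HONEST FRAMING. Nothing about BSD is proved here; no summit statement is proved by this seat; no stub is closed. This composes two
kernel theorems already in the tree: the CLASS-FIELD input `HerbrandKummer.exists_lift_stabilising_classField` (w8 g0, on the tree's
proved Hilbert class field `classFieldOfSubgroup K S`, `[M_S : K] = [Cl : S]`, unramified everywhere) and the KUMMER COUNT for an even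
normalised radical character `HerbrandKummer.natCard_gal_le_prime_mul_classGroupChiCard_of_normalised_kummer_even` (w7 g4, p680855:
`#Gal(M/K) ≤ p · #e_θ(ℤ_p ⊗ Cl K)`, the `p` being Herbrand's rank-one even eigenunit line). Together: Leopoldt's
«`r_p(Cl^{χ̄}) ≤ 1 + r_p(Cl^{ω χ̄⁻¹})`» for `χ̄` odd, in the counting form the census uses.

* **`index_le_prime_mul_classGroupChiCard_of_stable_subgroup`** — `K` CM, Galois/ℚ, `p ∤ [K:ℚ]`, `ζ ∈ K` a primitive `p`-th root of
  unity with `σ ζ = ζ^{a σ}`; `S ≤ Cl(𝓞 K)` with `σ • S ⊆ S`, `(σ•c)^{m σ} c⁻¹ ∈ S` and `c^p ∈ S` for all `σ, c`; the decomposition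
  condition at `p` (`∀ v ∋ p ∃ σ ∈ D_v`, `a σ m σ ≢ 1`); `θ : Gal(K/ℚ) →* ℤ_pˣ` lifting `σ ↦ a σ · m σ`, `θ ≠ 1`, `θ(c) = 1` ⊢
  `S.index ≤ p * classGroupChiCard ℚ K p θ`.
* `pow_mul_mul_inv_eq_one` — bookkeeping `x^{n m} x⁻¹ = 1` in `Multiplicative (ZMod p)` when `p ∣ m n − 1`.
* **`prime_le_classGroupChiCard_of_two_equivariant_classGroupHoms`** — with `n, m : Gal(K/ℚ) → ℕ`, `p ∣ m σ n σ − 1`, and two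
  `n̄`-equivariant characters `φ₁, φ₂ : Cl(𝓞 K) →* ℤ/p` (`φ(σ•c) = φ(c)^{n σ}`) which are jointly onto `ℤ/p × ℤ/p`:
  `p ≤ #e_θ(ℤ_p ⊗ Cl K)`; and `classGroupChiCard_ne_one_of_two_equivariant_classGroupHoms` (`≠ 1`, the EVEN-IRREGULAR currency of
  `KummerRadical.exists_two_independent_kummer_characters_of_classGroupChiCard_ne_one`). In the census (`n̄ = χ̄` the odd character of
  the Selmer line, `θ = ω∘(ā χ̄⁻¹)`): a NON-CYCLIC `χ̄`-isotypic quotient of `Cl(K)/p` forces even-irregularity at `θ_e = ω χ̄⁻¹`.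

References: [Washington1997] Thm. 10.9 and §10.2 (proof); [Lang1990] Ch. 13 §2 Thm. 2.1; [Cox2013] §5.C Cor. 5.24 (the class fields
`M_S`); [Gras2003] Ch. II §5 (reflection theorem).
-/

set_option autoImplicit false
-- `…BirchSwinnertonDyer.BirchSwinnertonDyer.Theorems…` is the problem's mandated namespace (D-0017).
set_option linter.dupNamespace false

noncomputable section

namespace Summit.BirchSwinnertonDyer.BirchSwinnertonDyer.Theorems.PrintCFram.HerbrandKummer

open Literature.NumberTheory.NumberFields Literature.NumberTheory.NumberFields.hilbertClassField
open NumberField NumberField.IsCMField IsDedekindDomain Module IntermediateField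
open scoped nonZeroDivisors Pointwise

section LeopoldtLower

variable {K : Type} [Field K] [NumberField K]

/-- **Leopoldt's reflection, lower direction (counting form).** Let `K` be a CM field, Galois over `ℚ` with `p ∤ [K : ℚ]`, `ζ ∈ K` a
primitive `p`-th root of unity with `σ ζ = ζ^{a σ}`. Let `S ≤ Cl(𝓞 K)` be stable under `Gal(K/ℚ)`, of exponent `p` (`c^p ∈ S`), with
`Gal(K/ℚ)` acting on `Cl/S` through `σ ↦ m̄(σ)⁻¹` (`(σ•c)^{m σ} c⁻¹ ∈ S`); assume the decomposition condition at `p` and let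
`θ : Gal(K/ℚ) →* ℤ_pˣ` be an EVEN lift `≠ 1` of `σ ↦ a σ · m σ` (the radical character `ω m̄`). Then
`[Cl(𝓞 K) : S] ≤ p · #e_θ(ℤ_p ⊗ Cl(𝓞 K))`: the class field `M_S/K` of `S` is abelian of exponent `p`, unramified, normalised by lifts
of every `σ` acting as `τ ↦ τ^{m σ}` (class field theory, `exists_lift_stabilising_classField`), so the Kummer count for even normalised
radicals applies (`natCard_gal_le_prime_mul_classGroupChiCard_of_normalised_kummer_even`), and `#Gal(M_S/K) = [Cl : S]`.
[cite: Washington1997, Thm. 10.9 and §10.2 (proof)] [cite: Lang1990, Ch. 13 §2 Thm. 2.1] [cite: Cox2013, §5.C Cor. 5.24] -/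
theorem index_le_prime_mul_classGroupChiCard_of_stable_subgroup [IsCMField K] [IsGalois ℚ K]
    {p : ℕ} [Fact p.Prime] (hpK : ¬ p ∣ Module.finrank ℚ K) {ζ : K} (hζ : IsPrimitiveRoot ζ p)
    (a m : (K ≃ₐ[ℚ] K) → ℕ) (ha : ∀ σ : K ≃ₐ[ℚ] K, σ ζ = ζ ^ a σ)
    (S : Subgroup (ClassGroup (𝓞 K)))
    (hS : ∀ (σ : K ≃ₐ[ℚ] K), ∀ c ∈ S, ClassGroup.mulEquiv (AmbiguousClass.intAut σ) c ∈ S)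
    (hact : ∀ (σ : K ≃ₐ[ℚ] K) (c : ClassGroup (𝓞 K)), (ClassGroup.mulEquiv (AmbiguousClass.intAut σ) c) ^ m σ * c⁻¹ ∈ S)
    (hSp : ∀ c : ClassGroup (𝓞 K), c ^ p ∈ S)
    (hdec : ∀ v : HeightOneSpectrum (𝓞 K), ((p : ℕ) : 𝓞 K) ∈ v.asIdeal →
      ∃ σ : K ≃ₐ[ℚ] K, σ • v.asIdeal = v.asIdeal ∧ ¬ ((a σ * m σ : ℕ) : ZMod p) = 1)
    (θ : (K ≃ₐ[ℚ] K) →* ℤ_[p]ˣ) (hθ : ∀ σ : K ≃ₐ[ℚ] K, ‖((θ σ : ℤ_[p]ˣ) : ℤ_[p]) - ((a σ * m σ : ℕ) : ℤ_[p])‖ < 1)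
    (hθ1 : θ ≠ 1) (hθc : θ ((complexConj K).restrictScalars ℚ) = 1) :
    S.index ≤ p * classGroupChiCard ℚ K p (fun g => ((θ g : ℤ_[p]ˣ) : ℤ_[p])) := by
  classical
  set M := classFieldOfSubgroup K S with hM
  obtain ⟨e, -⟩ := exists_quotient_mulEquiv_gal K S
  -- `Gal(M_S/K) ≅ Cl/S`: abelian of exponent `p`
  have hGexp : ∀ τ : M ≃ₐ[K] M, τ ^ p = 1 := by
    intro τ
    obtain ⟨q, rfl⟩ := e.surjective τ
    induction q using QuotientGroup.induction_on with
    | H c => rw [← map_pow, ← QuotientGroup.mk_pow, (QuotientGroup.eq_one_iff _).2 (hSp c), map_one]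
  have hGcomm : ∀ τ τ' : M ≃ₐ[K] M, τ * τ' = τ' * τ := by
    intro τ τ'
    obtain ⟨q, rfl⟩ := e.surjective τ
    obtain ⟨q', rfl⟩ := e.surjective τ'
    rw [← map_mul, ← map_mul, mul_comm]
  have hunr : ∀ v : HeightOneSpectrum (𝓞 K), ((p : ℕ) : 𝓞 K) ∉ v.asIdeal → Algebra.IsUnramifiedIn (𝓞 M) v.asIdeal :=
    fun v _ => classFieldOfSubgroup_isUnramifiedIn K S v
  have hlift : ∀ σ : K ≃ₐ[ℚ] K, ∃ (g : AlgebraicClosure K ≃ₐ[ℚ] AlgebraicClosure K)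
      (hgM : ∀ x : AlgebraicClosure K, x ∈ M → g x ∈ M),
      (∀ x : K, g (algebraMap K (AlgebraicClosure K) x) = algebraMap K (AlgebraicClosure K) (σ x)) ∧
      ∀ (τ : M ≃ₐ[K] M) (x : M), ((τ ⟨g x, hgM x x.2⟩ : M) : AlgebraicClosure K) =
        g (((τ ^ m σ) x : M) : AlgebraicClosure K) :=
    fun σ => exists_lift_stabilising_classField K σ S (m σ) (hS σ) (hact σ)
  have hcount := natCard_gal_le_prime_mul_classGroupChiCard_of_normalised_kummer_even hpK hζ M hGexp hGcomm hunr m a hlift ha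
    hdec θ hθ hθ1 hθc
  rwa [Nat.card_eq_fintype_card, ← Nat.card_eq_fintype_card, IsGalois.card_aut_eq_finrank, hM,
    finrank_classFieldOfSubgroup] at hcount

/-- Bookkeeping in `Multiplicative (ZMod p)`: `x^{n m} x⁻¹ = 1` when `p ∣ m n − 1` (and `1 ≤ m n`). [folklore] -/
theorem pow_mul_mul_inv_eq_one {p : ℕ} [Fact p.Prime] (x : Multiplicative (ZMod p)) {m n : ℕ} (hmn : p ∣ m * n - 1)
    (hmn1 : 1 ≤ m * n) : x ^ (n * m) * x⁻¹ = 1 := by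
  have hxp : x ^ p = 1 := by
    have h1 : x ^ Nat.card (Multiplicative (ZMod p)) = 1 := pow_card_eq_one'
    rwa [Nat.card_congr Multiplicative.toAdd, Nat.card_zmod] at h1
  obtain ⟨k, hk⟩ := hmn
  have hnm : n * m = p * k + 1 := by rw [mul_comm]; omega
  rw [hnm, pow_succ, pow_mul, hxp, one_pow, one_mul, mul_inv_cancel]

/-- **«`χ̄`-RANK ≥ 2 ⟹ EVEN-IRREGULAR».** Let `K` be a CM field, Galois over `ℚ` with `p ∤ [K : ℚ]`, `ζ ∈ K` a primitive `p`-th root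
of unity with `σ ζ = ζ^{a σ}`; `n, m : Gal(K/ℚ) → ℕ` with `p ∣ m σ n σ − 1`; the decomposition condition at `p`; `θ` an even lift
`≠ 1` of `σ ↦ a σ · m σ` («`θ_e = ω n̄⁻¹`», `n̄` odd). If `Cl(𝓞 K)` carries two `n̄`-equivariant characters
`φ₁, φ₂ : Cl(𝓞 K) →* ℤ/p` (`φ(σ•c) = φ(c)^{n σ}`) which are jointly onto `ℤ/p × ℤ/p` (a NON-CYCLIC `n̄`-isotypic quotient of
`Cl(K)/p`), then `p ≤ #e_θ(ℤ_p ⊗ Cl(𝓞 K))` — the main theorem for `S = ker φ₁ ⊓ ker φ₂`, `[Cl : S] = p²`.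
[cite: Washington1997, Thm. 10.9 and §10.2 (proof)] [cite: Lang1990, Ch. 13 §2 Thm. 2.1] -/
theorem prime_le_classGroupChiCard_of_two_equivariant_classGroupHoms [IsCMField K] [IsGalois ℚ K]
    {p : ℕ} [Fact p.Prime] (hpK : ¬ p ∣ Module.finrank ℚ K) {ζ : K} (hζ : IsPrimitiveRoot ζ p)
    (n m a : (K ≃ₐ[ℚ] K) → ℕ) (hmn : ∀ σ : K ≃ₐ[ℚ] K, p ∣ m σ * n σ - 1) (hmn1 : ∀ σ : K ≃ₐ[ℚ] K, 1 ≤ m σ * n σ)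
    (ha : ∀ σ : K ≃ₐ[ℚ] K, σ ζ = ζ ^ a σ)
    (hdec : ∀ v : HeightOneSpectrum (𝓞 K), ((p : ℕ) : 𝓞 K) ∈ v.asIdeal →
      ∃ σ : K ≃ₐ[ℚ] K, σ • v.asIdeal = v.asIdeal ∧ ¬ ((a σ * m σ : ℕ) : ZMod p) = 1)
    (θ : (K ≃ₐ[ℚ] K) →* ℤ_[p]ˣ) (hθ : ∀ σ : K ≃ₐ[ℚ] K, ‖((θ σ : ℤ_[p]ˣ) : ℤ_[p]) - ((a σ * m σ : ℕ) : ℤ_[p])‖ < 1)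
    (hθ1 : θ ≠ 1) (hθc : θ ((complexConj K).restrictScalars ℚ) = 1)
    (φ₁ φ₂ : ClassGroup (𝓞 K) →* Multiplicative (ZMod p))
    (hφ₁ : ∀ (σ : K ≃ₐ[ℚ] K) (c : ClassGroup (𝓞 K)), φ₁ (ClassGroup.mulEquiv (AmbiguousClass.intAut σ) c) = φ₁ c ^ n σ)
    (hφ₂ : ∀ (σ : K ≃ₐ[ℚ] K) (c : ClassGroup (𝓞 K)), φ₂ (ClassGroup.mulEquiv (AmbiguousClass.intAut σ) c) = φ₂ c ^ n σ)
    (hsurj : Function.Surjective (φ₁.prod φ₂)) :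
    p ≤ classGroupChiCard ℚ K p (fun g => ((θ g : ℤ_[p]ˣ) : ℤ_[p])) := by
  classical
  have hp : p.Prime := Fact.out
  set S : Subgroup (ClassGroup (𝓞 K)) := (φ₁.prod φ₂).ker with hSdef
  have hmemS : ∀ c : ClassGroup (𝓞 K), c ∈ S ↔ φ₁ c = 1 ∧ φ₂ c = 1 := fun c => by
    rw [hSdef, MonoidHom.ker_prod, Subgroup.mem_inf, MonoidHom.mem_ker, MonoidHom.mem_ker]
  have hpow : ∀ x : Multiplicative (ZMod p), x ^ p = 1 := fun x => by
    have h1 : x ^ Nat.card (Multiplicative (ZMod p)) = 1 := pow_card_eq_one'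
    rwa [Nat.card_congr Multiplicative.toAdd, Nat.card_zmod] at h1
  have hS : ∀ (σ : K ≃ₐ[ℚ] K), ∀ c ∈ S, ClassGroup.mulEquiv (AmbiguousClass.intAut σ) c ∈ S := fun σ c hc => by
    rw [hmemS] at hc ⊢
    rw [hφ₁, hφ₂, hc.1, hc.2, one_pow]
    exact ⟨rfl, rfl⟩
  have hact : ∀ (σ : K ≃ₐ[ℚ] K) (c : ClassGroup (𝓞 K)),
      (ClassGroup.mulEquiv (AmbiguousClass.intAut σ) c) ^ m σ * c⁻¹ ∈ S := fun σ c => by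
    rw [hmemS, map_mul, map_mul, map_pow, map_pow, map_inv, map_inv, hφ₁, hφ₂, ← pow_mul, ← pow_mul]
    exact ⟨pow_mul_mul_inv_eq_one _ (hmn σ) (hmn1 σ), pow_mul_mul_inv_eq_one _ (hmn σ) (hmn1 σ)⟩
  have hSp : ∀ c : ClassGroup (𝓞 K), c ^ p ∈ S := fun c => by
    rw [hmemS, map_pow, map_pow]
    exact ⟨hpow _, hpow _⟩
  have hidx : S.index = p * p := by
    rw [hSdef, Subgroup.index_ker, MonoidHom.range_eq_top.2 hsurj, Subgroup.card_top, Nat.card_prod,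
      Nat.card_congr Multiplicative.toAdd, Nat.card_zmod]
  have h := index_le_prime_mul_classGroupChiCard_of_stable_subgroup hpK hζ a m ha S hS hact hSp hdec θ hθ hθ1 hθc
  rw [hidx] at h
  exact Nat.le_of_mul_le_mul_left h hp.pos

/-- The same as **EVEN-IRREGULARITY**: `#e_θ(ℤ_p ⊗ Cl(𝓞 K)) ≠ 1` — the hypothesis currency of
`KummerRadical.exists_two_independent_kummer_characters_of_classGroupChiCard_ne_one`.
[cite: Washington1997, Thm. 10.9 and §10.2 (proof)] -/
theorem classGroupChiCard_ne_one_of_two_equivariant_classGroupHoms [IsCMField K] [IsGalois ℚ K]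
    {p : ℕ} [Fact p.Prime] (hpK : ¬ p ∣ Module.finrank ℚ K) {ζ : K} (hζ : IsPrimitiveRoot ζ p)
    (n m a : (K ≃ₐ[ℚ] K) → ℕ) (hmn : ∀ σ : K ≃ₐ[ℚ] K, p ∣ m σ * n σ - 1) (hmn1 : ∀ σ : K ≃ₐ[ℚ] K, 1 ≤ m σ * n σ)
    (ha : ∀ σ : K ≃ₐ[ℚ] K, σ ζ = ζ ^ a σ)
    (hdec : ∀ v : HeightOneSpectrum (𝓞 K), ((p : ℕ) : 𝓞 K) ∈ v.asIdeal →
      ∃ σ : K ≃ₐ[ℚ] K, σ • v.asIdeal = v.asIdeal ∧ ¬ ((a σ * m σ : ℕ) : ZMod p) = 1)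
    (θ : (K ≃ₐ[ℚ] K) →* ℤ_[p]ˣ) (hθ : ∀ σ : K ≃ₐ[ℚ] K, ‖((θ σ : ℤ_[p]ˣ) : ℤ_[p]) - ((a σ * m σ : ℕ) : ℤ_[p])‖ < 1)
    (hθ1 : θ ≠ 1) (hθc : θ ((complexConj K).restrictScalars ℚ) = 1)
    (φ₁ φ₂ : ClassGroup (𝓞 K) →* Multiplicative (ZMod p))
    (hφ₁ : ∀ (σ : K ≃ₐ[ℚ] K) (c : ClassGroup (𝓞 K)), φ₁ (ClassGroup.mulEquiv (AmbiguousClass.intAut σ) c) = φ₁ c ^ n σ)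
    (hφ₂ : ∀ (σ : K ≃ₐ[ℚ] K) (c : ClassGroup (𝓞 K)), φ₂ (ClassGroup.mulEquiv (AmbiguousClass.intAut σ) c) = φ₂ c ^ n σ)
    (hsurj : Function.Surjective (φ₁.prod φ₂)) :
    classGroupChiCard ℚ K p (fun g => ((θ g : ℤ_[p]ˣ) : ℤ_[p])) ≠ 1 := by
  have hp : p.Prime := Fact.out
  have h := prime_le_classGroupChiCard_of_two_equivariant_classGroupHoms hpK hζ n m a hmn hmn1 ha hdec θ hθ hθ1 hθc φ₁ φ₂
    hφ₁ hφ₂ hsurj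
  intro h1
  rw [h1] at h
  exact absurd h (not_le.2 hp.one_lt)

end LeopoldtLower

end Summit.BirchSwinnertonDyer.BirchSwinnertonDyer.Theorems.PrintCFram.HerbrandKummer

end
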